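import Summits.HodgeConjecture.HodgeConjecture.Theses.KugaSatakeSaturation
import Literature.AlgebraicGeometry.Motives.KugaSatakeFullEmbedding

/-!
# Route `KugaSatakeSaturation` — support item `KSEmbeddingHodge` (stmt-HodgeConjecture-9375)

Both sanity / non-vacuity items of the route (this one and `KSWellDefined`, stmt-HodgeConjecture-9374,
closed in the sibling file `KugaSatakeSaturationKSWellDefined.lean`) are, up to unfolding, theorems of the
Literature file
`Motives/KugaSatakeFull` / `Motives/KugaSatakeFullEmbedding` (the full-Clifford Kuga–Satake Hodge
structure, vG §5–6 / Huybrechts Ch. 4 §2): `kugaSatakeFullF1 H P` is BY `rfl` the route's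
`F¹_KS = Submodule.map ((CliffordAlgebra.ι Q_P).baseChange ℂ) (H.piece 2 0) * ⊤`
(`kugaSatakeFullF1_eq`), `P.quadraticForm = LinearMap.BilinMap.toQuadraticMap P.form`, and the route's
embedding `μ₀ = (LinearMap.mul ℚ C).comp (CliffordAlgebra.ι Q_P)` is `KugaSatake.leftEmbedding`.

* `KSWellDefined` = `kugaSatakeFull_wellDefined`: `C(Q)_ℂ = F¹_KS ⊕ conj F¹_KS` and
  `2 dim_ℂ F¹_KS = dim_ℚ C(Q)` (`ω² = Q(ω) = 0`, `ωω̄ + ω̄ω = 2P(ω, ω̄) ≠ 0`, `dim C(q) = 2^{dim V}`);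
* `KSEmbeddingHodge` = `kugaSatakeFull_leftEmbedding_hodge`: `L_{ι θ}` preserves `F¹_KS` for
  `θ ∈ F¹V_ℂ`, and for `θ ∈ V^{2,0}` maps `C(Q)_ℂ` into `F¹_KS` and `F¹_KS` to `0`.

The route's extra hypothesis `H.F 3 = ⊥` is not needed.  No definition, no named-fact hypothesis,
no sorry.
-/

set_option linter.dupNamespace false

noncomputable section

namespace Summit.HodgeConjecture.HodgeConjecture.Theorems

open Literature.AlgebraicGeometry.Motives Literature.AlgebraicGeometry.Motives.HodgeStructure

/-- **Item stmt-HodgeConjecture-9375 (`KSEmbeddingHodge`, route `KugaSatakeSaturation`)**: the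
Kuga–Satake embedding `μ₀ = t ↦ L_{ι t}` satisfies the Hodge conditions — for `w ∈ F¹T`, `(μ₀)_ℂ w`
preserves `F¹_KS`; for `w ∈ T^{2,0}` it maps `C_ℂ` into `F¹_KS` and kills `F¹_KS` — the Literature
theorem `kugaSatakeFull_leftEmbedding_hodge` (vG Prop. 6.3; Huybrechts Ch. 4 Prop. 2.6), verbatim up to
`rfl`-unfolding.  The type is literally the route decl
`Summit.HodgeConjecture.HodgeConjecture.Theses.KugaSatakeSaturation.KSEmbeddingHodge`.
[cite: vanGeemen2000KugaSatakeHC, Prop. 6.3] [cite: Huybrechts2016K3, Ch. 4 Prop. 2.6] -/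
theorem kugaSatakeSaturation_ksEmbeddingHodge_proof :
    Summit.HodgeConjecture.HodgeConjecture.Theses.KugaSatakeSaturation.KSEmbeddingHodge := by
  intro T _ _ _ H P _ h20 w hw
  exact kugaSatakeFull_leftEmbedding_hodge H P h20 w hw

end Summit.HodgeConjecture.HodgeConjecture.Theorems

end
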